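import Literature.Analysis.Calculus.RegularZeroSetOneDimProofs
import Literature.Geometry.Manifold.VectorSpaceGlobalFlow
import Literature.Geometry.Manifold.FlowPeriodicFamily
import HarnessLib

/-!
# The twist field of a complete set of first integrals, its flow, and the Dehn twist about a
# regular closed level curve

General differential topology (topic `Geometry/Manifold`), capstone of the generic part of the
Dehn-twist package of the Dehn–Nielsen–Baer seat (`FlowTimeReparametrisation.lean`,
`FlowPeriodFunction.lean`, `FlowPeriodicFamily.lean`, `VectorSpaceGlobalFlow.lean`).  On a
finite-dimensional real normed space `E` let `H : E → F` be smooth with `dim E = dim F + 1` (a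
complete set of first integrals-to-be: the regular level sets of `H` are curves) and `ψ : E → ℝ` a
smooth cut-off vanishing off a compact set.  The **twist field** is

  `V = ψ · v_H`,  `v_H` the cross-product tangent field of the level sets of `H`

(`Literature.Analysis.Calculus.MilnorOneDim.tangentField`, the generalized cross product of the rows
of `DH`; in `ℝ³` with `H = (F, h)` this is `ψ · ∇F × ∇h`, in `ℝ²` it is `ψ · J∇H`):

* `twistField`, `contDiff_twistField`, `fderiv_apply_twistField` (`dH(V) = 0`),
  `twistField_ne_zero` (`V ≠ 0` where `ψ ≠ 0` and `DH` is onto), `twistField_eq_zero`;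
* `exists_levelFlow` — **`V` has a smooth global flow `θ` preserving `H`** and fixing `{ψ = 0}`
  (`exists_contDiff_globalFlow`, `apply_flow_eq_of_fderiv_comp_eq_zero`);
* `exists_levelTwist` — **the Dehn twist about a regular closed level curve**: given moreover a
  smooth section `σ` of `H` over an open set `J` through points where `ψ ≠ 0` and `DH` is onto, the
  flow `θ` is produced, and IF the orbit of `σ s₀` is closed with a positive period `T₀`
  (`θ(T₀, σ s₀) = σ s₀` — the one genuinely geometric input, e.g. from compactness of the level
  curve), then on some open `S ∋ s₀` every smooth bump `μ` in the first integrals supported in a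
  closed subset of `S` yields a diffeomorphism `T` of `E` with `H ∘ T = H`, `T = id` on `{ψ = 0}`
  and off the family of closed orbits over `S`, `T x = θ(μ(H x)·P(H x), x)` on that family (`P` the
  smooth period function, `P s₀ = T₀`), and `T = id` where `μ ∘ H = 1` (a full turn) —
  Farb–Margalit's twist map, §3.1.1.  For the level function of a regular sublevel set of `ℝ³`
  taken as a component of `H`, `T` restricts to a Dehn twist of the boundary surface
  (`RegularSublevel.boundaryRestrictDiffeomorph`).

* `exists_pos_period_of_isCompact_connectedComponentIn` — **a compact component of a regular
  level curve inside `{ψ = 1}` is a closed orbit of positive period** (Milnor's dichotomy for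
  one-dimensional regular zero sets, `RegularZeroSetOneDimProofs.lean`, and uniqueness for
  `x' = V x`); whence `exists_levelTwist_of_isCompact` — the twist with the periodicity hypothesis
  discharged: the user supplies only `H, ψ, σ, U` and the compactness of one level component.

Everything is proved; one definition (`twistField`), no named facts (D-0026).

## References

* B. Farb, D. Margalit, *A primer on mapping class groups*, PMS 49 (2012), §3.1.1 (PDF p. 62).
  [FarbMargalit2012]
* J. M. Lee, *Introduction to Smooth Manifolds*, 2nd ed., GTM 218 (2012), Thm. 9.12, Thm. 9.16,
  Thm. C.34. [LeeSmoothManifolds2013]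
* J. Milnor, *Topology from the Differentiable Viewpoint* (1965), §2 Lemma 1 (regular level sets).
  [MilnorTDV1965]
-/

open scoped Manifold ContDiff Topology
open Set Function Filter

noncomputable section

namespace Literature.Geometry.Manifold

open Literature.Analysis.Calculus.MilnorOneDim

section TwistField

variable {E F : Type*} [NormedAddCommGroup E] [NormedSpace ℝ E]
  [NormedAddCommGroup F] [NormedSpace ℝ F]
  {ι : Type*} [Fintype ι] [DecidableEq ι] (bE : Module.Basis (ι ⊕ Fin 1) ℝ E) (bF : Module.Basis ι ℝ F)

/-- **The twist field** `V = ψ · v_H` of a map `H : E → F` (`dim E = dim F + 1`) cut off by `ψ`: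
`v_H` the cross-product tangent field of the level sets of `H`. [cite: FarbMargalit2012, §3.1.1] -/
def twistField (H : E → F) (ψ : E → ℝ) (x : E) : E := ψ x • tangentField bE bF H x

variable {bE bF}

/-- Unfolding. [folklore] -/
theorem twistField_apply (H : E → F) (ψ : E → ℝ) (x : E) :
    twistField bE bF H ψ x = ψ x • tangentField bE bF H x := rfl

/-- The twist field of smooth data is smooth. [folklore] -/
theorem contDiff_twistField [FiniteDimensional ℝ F] {H : E → F} (hH : ContDiff ℝ ∞ H) {ψ : E → ℝ} (hψ : ContDiff ℝ ∞ ψ) :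
    ContDiff ℝ ∞ (twistField bE bF H ψ) := by
  have ht : ContDiffOn ℝ ∞ (tangentField bE bF H) univ :=
    contDiffOn_kerVec_fderiv bE bF isOpen_univ hH.contDiffOn
  rw [contDiffOn_univ] at ht
  exact hψ.smul ht

/-- **The twist field is tangent to the level sets of `H`**: `dH(V) = 0`. [folklore] -/
theorem fderiv_apply_twistField (H : E → F) (ψ : E → ℝ) (x : E) :
    fderiv ℝ H x (twistField bE bF H ψ x) = 0 := by
  rw [twistField_apply, map_smul, fderiv_tangentField, smul_zero]

/-- The twist field vanishes where the cut-off does. [folklore] -/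
theorem twistField_eq_zero {H : E → F} {ψ : E → ℝ} {x : E} (hx : ψ x = 0) :
    twistField bE bF H ψ x = 0 := by
  rw [twistField_apply, hx, zero_smul]

/-- **The twist field does not vanish where the cut-off does not and `DH` is onto.** [folklore] -/
theorem twistField_ne_zero {H : E → F} {ψ : E → ℝ} {x : E} (hx : ψ x ≠ 0)
    (hreg : LinearMap.range (fderiv ℝ H x : E →ₗ[ℝ] F) = ⊤) : twistField bE bF H ψ x ≠ 0 :=
  smul_ne_zero hx (tangentField_ne_zero hreg)

omit [DecidableEq ι] in
/-- The dimension count encoded by the bases: `dim E = dim F + 1`. [folklore] -/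
theorem finrank_eq_of_bases (bE : Module.Basis (ι ⊕ Fin 1) ℝ E) (bF : Module.Basis ι ℝ F) :
    Module.finrank ℝ E = Module.finrank ℝ F + 1 := by
  rw [Module.finrank_eq_card_basis bE, Module.finrank_eq_card_basis bF, Fintype.card_sum,
    Fintype.card_fin]

/-- **The smooth global flow of the twist field**: it preserves `H` and fixes `{ψ = 0}`
pointwise. [cite: LeeSmoothManifolds2013, Thm. 9.16 and Thm. 9.12] -/
theorem exists_levelFlow [FiniteDimensional ℝ E] [FiniteDimensional ℝ F] {H : E → F} (hH : ContDiff ℝ ∞ H) {ψ : E → ℝ} (hψ : ContDiff ℝ ∞ ψ)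
    {K : Set E} (hK : IsCompact K) (hψK : ∀ x, x ∉ K → ψ x = 0) :
    ∃ θ : ℝ × E → E, ContDiff ℝ ∞ θ ∧ (∀ x, θ (0, x) = x) ∧
      (∀ t s x, θ (t, θ (s, x)) = θ (t + s, x)) ∧
      (∀ x t, HasDerivAt (fun t => θ (t, x)) (twistField bE bF H ψ (θ (t, x))) t) ∧
      (∀ x, twistField bE bF H ψ x = 0 → ∀ t, θ (t, x) = x) ∧
      (∀ t x, H (θ (t, x)) = H x) ∧
      ∀ x, ψ x = 0 → ∀ t, θ (t, x) = x := by
  obtain ⟨θ, hθ, h0, hadd, hint, hfix⟩ := exists_contDiff_globalFlow (contDiff_twistField (bE := bE) (bF := bF) hH hψ) hK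
    fun x hx => twistField_eq_zero (hψK x hx)
  refine ⟨θ, hθ, h0, hadd, hint, hfix, fun t x => ?_, fun x hx => hfix x (twistField_eq_zero hx)⟩
  exact apply_flow_eq_of_fderiv_comp_eq_zero h0 hint (hH.differentiable (by simp))
    (fderiv_apply_twistField H ψ) t x

/-- **The Dehn twist about a regular closed level curve.**  See the file header.  The only
hypothesis not discharged here is the closedness of ONE orbit, `θ(T₀, σ s₀) = σ s₀` with `T₀ > 0`.
[cite: FarbMargalit2012, §3.1.1] [cite: LeeSmoothManifolds2013, Thm. 9.12 and Thm. C.34] -/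
theorem exists_levelTwist [FiniteDimensional ℝ E] [FiniteDimensional ℝ F] {H : E → F} (hH : ContDiff ℝ ∞ H) {ψ : E → ℝ} (hψ : ContDiff ℝ ∞ ψ)
    {K : Set E} (hK : IsCompact K) (hψK : ∀ x, x ∉ K → ψ x = 0)
    {σ : F → E} (hσ : ContDiff ℝ ∞ σ) {J : Set F} (hJ : IsOpen J) {s₀ : F} (hs₀ : s₀ ∈ J)
    (hHσ : ∀ s ∈ J, H (σ s) = s) (hψσ : ∀ s ∈ J, ψ (σ s) ≠ 0)
    (hreg : ∀ s ∈ J, LinearMap.range (fderiv ℝ H (σ s) : E →ₗ[ℝ] F) = ⊤) :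
    ∃ θ : ℝ × E → E, ContDiff ℝ ∞ θ ∧ (∀ x, θ (0, x) = x) ∧
      (∀ t s x, θ (t, θ (s, x)) = θ (t + s, x)) ∧
      (∀ x t, HasDerivAt (fun t => θ (t, x)) (twistField bE bF H ψ (θ (t, x))) t) ∧
      (∀ t x, H (θ (t, x)) = H x) ∧ (∀ x, ψ x = 0 → ∀ t, θ (t, x) = x) ∧
      ∀ T₀ : ℝ, 0 < T₀ → θ (T₀, σ s₀) = σ s₀ →
        ∃ (P : F → ℝ) (S : Set F), IsOpen S ∧ s₀ ∈ S ∧ S ⊆ J ∧ P s₀ = T₀ ∧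
          (∀ s ∈ S, θ (P s, σ s) = σ s) ∧
          ∀ (μ : F → ℝ), ContDiff ℝ ∞ μ → ∀ C : Set F, IsClosed C → C ⊆ S → (∀ s ∉ C, μ s = 0) →
            ∃ T : E ≃ₘ⟮𝓘(ℝ, E), 𝓘(ℝ, E)⟯ E,
              (∀ x, H (T x) = H x) ∧
              (∀ x, ψ x = 0 → T x = x) ∧
              (∀ x, x ∉ flowSaturation θ σ S → T x = x) ∧
              (∀ x ∈ flowSaturation θ σ S, T x = θ (μ (H x) * P (H x), x)) ∧
              ∀ x, μ (H x) = 1 → T x = x := by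
  obtain ⟨θ, hθ, h0, hadd, hint, hfix, hHinv, hψfix⟩ := exists_levelFlow (bE := bE) (bF := bF) hH hψ hK hψK
  refine ⟨θ, hθ, h0, hadd, hint, hHinv, hψfix, fun T₀ hT₀ hT => ?_⟩
  have hvel : ∀ u : ℝ, ∀ s ∈ J, ∃ v : E, v ≠ 0 ∧ HasDerivAt (fun t => θ (t, σ s)) v u :=
    exists_velocity_ne_zero h0 hadd hfix hint fun s hs => twistField_ne_zero (hψσ s hs) (hreg s hs)
  obtain ⟨P, S, hSo, hs₀S, hSJ, hP0, hPS, htwist⟩ :=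
    exists_twistDiffeomorph (finrank_eq_of_bases bE bF) hθ h0 hadd hH hHinv hσ hJ hs₀ hHσ hT₀ hT hvel
  refine ⟨P, S, hSo, hs₀S, hSJ, hP0, hPS, fun μ hμ C hC hCS hμC => ?_⟩
  obtain ⟨T, hTH, hToff, hTon, hT1⟩ := htwist μ hμ C hC hCS hμC
  refine ⟨T, hTH, fun x hx => ?_, hToff, hTon, hT1⟩
  by_cases hmem : x ∈ flowSaturation θ σ S
  · rw [hTon x hmem]; exact hψfix x hx _
  · exact hToff x hmem


/-! ### Closed orbits from compact level components -/

/-- **A compact component of a regular level curve is a closed orbit of the twist flow.**  Let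
`θ` be a global flow whose curves have velocity `V = ψ · v_H` (e.g. the flow of `exists_levelFlow`),
`U` an open set on which `ψ = 1` and on which the level `H = s₀` is regular, and `z ∈ U` a point of
that level whose connected component in `U ∩ H⁻¹(s₀)` is compact.  Then the orbit of `z` is closed
with a positive period.  (The component is the orbit of the tangent flow inside `U` —
`MilnorOneDim.orbit_eq_connectedComponentIn` —; were the maximal tangent solution injective the
component would be a line, `MilnorOneDim.nonempty_homeomorph_real_of_injOn`, not compact; two equal
values of the tangent solution are two equal values of `t ↦ θ(t, z)` by uniqueness of solutions of
`x' = V x`, and the group law turns them into a period.)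
[cite: MilnorTDV1965, §2 Lemma 1 and Appendix] -/
theorem exists_pos_period_of_isCompact_connectedComponentIn [FiniteDimensional ℝ E]
    [FiniteDimensional ℝ F] {H : E → F} (hH : ContDiff ℝ ∞ H) {ψ : E → ℝ} (hψ : ContDiff ℝ ∞ ψ)
    {θ : ℝ × E → E} (h0 : ∀ x, θ (0, x) = x) (hadd : ∀ t s x, θ (t, θ (s, x)) = θ (t + s, x))
    (hint : ∀ x t, HasDerivAt (fun t => θ (t, x)) (twistField bE bF H ψ (θ (t, x))) t)
    {U : Set E} (hU : IsOpen U) (hψU : ∀ x ∈ U, ψ x = 1) {s₀ : F}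
    (hreg : ∀ x ∈ U, H x = s₀ → LinearMap.range (fderiv ℝ H x : E →ₗ[ℝ] F) = ⊤)
    {z : E} (hz : z ∈ U) (hz0 : H z = s₀)
    (hK : IsCompact (connectedComponentIn (U ∩ H ⁻¹' {s₀}) z)) :
    ∃ T : ℝ, 0 < T ∧ θ (T, z) = z := by
  classical
  -- the zero set of `f = H - s₀` and its tangent field (`= v_H`)
  set f : E → F := fun x => H x - s₀ with hfdef
  have hf : ContDiffOn ℝ ∞ f U := (hH.sub contDiff_const).contDiffOn
  have hfderiv : ∀ x, fderiv ℝ f x = fderiv ℝ H x := fun x => by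
    rw [hfdef]; exact fderiv_sub_const s₀
  have htf : tangentField bE bF f = tangentField bE bF H := by
    funext x; simp only [tangentField, hfderiv]
  have hzero : U ∩ f ⁻¹' {0} = U ∩ H ⁻¹' {s₀} := by
    ext x; simp [hfdef, sub_eq_zero]
  have hz0' : f z = 0 := by simp [hfdef, hz0]
  have hreg' : ∀ x ∈ U, f x = 0 → LinearMap.range (fderiv ℝ f x : E →ₗ[ℝ] F) = ⊤ := by
    intro x hx hx0
    rw [hfderiv]
    exact hreg x hx (by simpa [hfdef, sub_eq_zero] using hx0)
  have hv : ∀ x ∈ U, ContDiffAt ℝ 1 (tangentField bE bF f) x := tangentField_contDiffAt hU hf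
  -- the maximal tangent solution from `z` is not injective (its orbit is the compact component)
  have hnotinj : ¬ InjOn (flow (tangentField bE bF f) U z) (flowDom (tangentField bE bF f) U z) := by
    intro hinj
    obtain ⟨e⟩ := nonempty_homeomorph_real_of_injOn hU hf hreg' hz hz0' hinj
    have hco : IsCompact (orbit bE bF f U z) := by
      rw [orbit_eq_connectedComponentIn hU hf hreg' hz hz0', hzero]; exact hK
    haveI : CompactSpace (orbit bE bF f U z) := isCompact_iff_compactSpace.1 hco
    haveI : CompactSpace ℝ := e.compactSpace
    exact noncompact_univ ℝ isCompact_univ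
  -- two equal values of the tangent solution
  obtain ⟨t₁, ht₁, t₂, ht₂, heq, hne⟩ : ∃ t₁ ∈ flowDom (tangentField bE bF f) U z,
      ∃ t₂ ∈ flowDom (tangentField bE bF f) U z,
      flow (tangentField bE bF f) U z t₁ = flow (tangentField bE bF f) U z t₂ ∧ t₁ ≠ t₂ := by
    simp only [InjOn, not_forall] at hnotinj
    obtain ⟨t₁, ht₁, t₂, ht₂, heq, hne⟩ := hnotinj
    exact ⟨t₁, ht₁, t₂, ht₂, heq, hne⟩
  -- our curve `t ↦ θ(t, z)` agrees with the tangent solution on its domain (uniqueness for `V`)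
  have hV1 : ∀ x ∈ (univ : Set E), ContDiffAt ℝ 1 (twistField bE bF H ψ) x := fun x _ =>
    ((contDiff_twistField (bE := bE) (bF := bF) hH hψ).of_le (by exact_mod_cast le_top)).contDiffAt
  have hsolθ : IsSolOn (twistField bE bF H ψ) univ (fun t => θ (t, z))
      (flowDom (tangentField bE bF f) U z) :=
    ⟨fun t _ => hint z t, mapsTo_univ _ _⟩
  have hsolφ : IsSolOn (twistField bE bF H ψ) univ (flow (tangentField bE bF f) U z)
      (flowDom (tangentField bE bF f) U z) := by
    refine ⟨fun t ht => ?_, mapsTo_univ _ _⟩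
    have hd := hasDerivAt_flow hv ht
    have hmem : flow (tangentField bE bF f) U z t ∈ U := flow_mem hv ht
    have hVv : twistField bE bF H ψ (flow (tangentField bE bF f) U z t) =
        tangentField bE bF f (flow (tangentField bE bF f) U z t) := by
      rw [twistField_apply, hψU _ hmem, one_smul, htf]
    rw [hVv]
    exact hd
  have hagree : EqOn (fun t => θ (t, z)) (flow (tangentField bE bF f) U z)
      (flowDom (tangentField bE bF f) U z) :=
    IsSolOn.eqOn hV1 (isTimeDom_flowDom hU hv hz) hsolθ hsolφ (by simp [h0, flow_zero])
  have heqθ : θ (t₁, z) = θ (t₂, z) := by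
    have h1 := hagree ht₁
    have h2 := hagree ht₂
    simp only at h1 h2
    rw [h1, h2, heq]
  -- the group law turns the coincidence into a period
  have hper : ∀ a b : ℝ, θ (a, z) = θ (b, z) → θ (b - a, z) = z := by
    intro a b hab
    have : θ (-a, θ (b, z)) = θ (-a, θ (a, z)) := by rw [hab]
    rw [hadd, hadd, neg_add_cancel, h0, neg_add_eq_sub] at this
    exact this
  rcases lt_or_gt_of_ne hne with hlt | hlt
  · exact ⟨t₂ - t₁, sub_pos.2 hlt, hper t₁ t₂ heqθ⟩
  · exact ⟨t₁ - t₂, sub_pos.2 hlt, hper t₂ t₁ heqθ.symm⟩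

include bE bF in
/-- **The Dehn twist about a compact regular level curve.**  As `exists_levelTwist`, with the
closedness of the orbit of `σ s₀` DISCHARGED by the compactness of the connected component of `σ s₀`
in the level `H = H(σ s₀)` inside an open set `U ∋ σ s₀` on which `ψ = 1` and the level is regular
(`exists_pos_period_of_isCompact_connectedComponentIn`).  What is left to the user is entirely
explicit: the data `H, ψ, σ, U` and the compactness of one level curve component.
[cite: FarbMargalit2012, §3.1.1] [cite: MilnorTDV1965, §2 Lemma 1 and Appendix] -/
theorem exists_levelTwist_of_isCompact [FiniteDimensional ℝ E] [FiniteDimensional ℝ F]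
    {H : E → F} (hH : ContDiff ℝ ∞ H) {ψ : E → ℝ} (hψ : ContDiff ℝ ∞ ψ)
    {K : Set E} (hK : IsCompact K) (hψK : ∀ x, x ∉ K → ψ x = 0)
    {σ : F → E} (hσ : ContDiff ℝ ∞ σ) {J : Set F} (hJ : IsOpen J) {s₀ : F} (hs₀ : s₀ ∈ J)
    (hHσ : ∀ s ∈ J, H (σ s) = s) (hψσ : ∀ s ∈ J, ψ (σ s) ≠ 0)
    (hreg : ∀ s ∈ J, LinearMap.range (fderiv ℝ H (σ s) : E →ₗ[ℝ] F) = ⊤)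
    {U : Set E} (hU : IsOpen U) (hψU : ∀ x ∈ U, ψ x = 1) (hσU : σ s₀ ∈ U)
    (hregU : ∀ x ∈ U, H x = s₀ → LinearMap.range (fderiv ℝ H x : E →ₗ[ℝ] F) = ⊤)
    (hcpt : IsCompact (connectedComponentIn (U ∩ H ⁻¹' {s₀}) (σ s₀))) :
    ∃ θ : ℝ × E → E, ContDiff ℝ ∞ θ ∧ (∀ x, θ (0, x) = x) ∧
      (∀ t s x, θ (t, θ (s, x)) = θ (t + s, x)) ∧
      (∀ t x, H (θ (t, x)) = H x) ∧ (∀ x, ψ x = 0 → ∀ t, θ (t, x) = x) ∧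
      ∃ (T₀ : ℝ) (P : F → ℝ) (S : Set F), 0 < T₀ ∧ θ (T₀, σ s₀) = σ s₀ ∧
        IsOpen S ∧ s₀ ∈ S ∧ S ⊆ J ∧ P s₀ = T₀ ∧ (∀ s ∈ S, θ (P s, σ s) = σ s) ∧
        ∀ (μ : F → ℝ), ContDiff ℝ ∞ μ → ∀ C : Set F, IsClosed C → C ⊆ S → (∀ s ∉ C, μ s = 0) →
          ∃ T : E ≃ₘ⟮𝓘(ℝ, E), 𝓘(ℝ, E)⟯ E,
            (∀ x, H (T x) = H x) ∧
            (∀ x, ψ x = 0 → T x = x) ∧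
            (∀ x, x ∉ flowSaturation θ σ S → T x = x) ∧
            (∀ x ∈ flowSaturation θ σ S, T x = θ (μ (H x) * P (H x), x)) ∧
            ∀ x, μ (H x) = 1 → T x = x := by
  obtain ⟨θ, hθ, h0, hadd, hint, hHinv, hψfix, htw⟩ :=
    exists_levelTwist (bE := bE) (bF := bF) hH hψ hK hψK hσ hJ hs₀ hHσ hψσ hreg
  obtain ⟨T₀, hT₀, hT⟩ := exists_pos_period_of_isCompact_connectedComponentIn (bE := bE) (bF := bF)
    hH hψ h0 hadd hint hU hψU hregU hσU (hHσ s₀ hs₀) hcpt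
  obtain ⟨P, S, hSo, hs₀S, hSJ, hP0, hPS, htwist⟩ := htw T₀ hT₀ hT
  exact ⟨θ, hθ, h0, hadd, hHinv, hψfix, T₀, P, S, hT₀, hT, hSo, hs₀S, hSJ, hP0, hPS, htwist⟩

end TwistField

end Literature.Geometry.Manifold

end
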